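import Literature.NumberTheory.Transcendental.GammaLocusOverK
import Literature.NumberTheory.Transcendental.GammaRelativeKummer
import HarnessLib

/-!
# The geometric step of Bays–Kirby 2018, Prop. 11.2: a generic partner from generic strong Γ-closedness

M. Bays, J. Kirby, *Pseudo-exponential maps, variants, and quasiminimality*, Algebra & Number
Theory 12 (2018), Prop. 11.2 / Thm 11.6 (proof): "GSΓC gives `ℵ₀`-saturation for Γ-algebraic
extensions over `K`". This file carries out the core case — the partner of a *free* Γ-algebraic
basis `b` over `⟨K c⟩` whose Γ-field `⟨K c⟩` is relatively algebraically closed in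
`⟨K c⟩(b, exp b)` — following the printed proof of Lemma 8.3 with axiom 4 (strong
exponential-algebraic closedness) replaced by generic strong Γ-closedness over `K` (Def. 11.1,
`GammaField.IsGenericallyStronglyGammaClosedOver`):

* `GammaField.exists_generic_partner_of_gsgc` — with `θ : ⟨K c⟩ ≅ ⟨K c'⟩` the field isomorphism
  of the Γ-isomorphism `c ↦ c'` and `P' = θ(I((b, exp b)/⟨K c⟩))`, the variety `W₀ = Z(P')_F` is
  irreducible (`GammaField.isPrime_map_locusIdeal'`, regularity), meets `Gⁿ`, has dimension `n`,
  and is free and rotund (`LocusComponents.lean`, `ZilberFieldSaturationMain.lean`); it is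
  defined over `K(α')`, `α' = (c'/M!, exp(c'/M!))` for large `M`, and
  `W = Loc(α', V/K) ∩ G^{N+n}` is strongly rotund (`GammaLocusOverK.lean`). GSΓC gives
  `(g, exp g) ∈ W₀` with `g` linearly independent over `K + ℚc'`; as `K + ℚc' ◁ F`,
  `td(g/K + ℚc') ≥ n = dim W₀`, so `(g, exp g)` is generic in `Z(P')` over `⟨K c'⟩`
  (`LocusComponents.isGenericPt_of_trdeg_le`).
* `GammaField.exists_isGammaIso_append_of_gsgc` — genericity yields a field embedding
  `⟨K c⟩(b, exp b) → F` over `θ` with `(b, exp b) ↦ (g, exp g)` (`GammaField.pointFieldHom`);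
  when `exp b` is Kummer-independent in `⟨K c⟩(b, exp b)` (a *normalised* good basis,
  `GammaField.exists_relative_normalised_basis`), this is a Γ-isomorphism
  `(c, b) ↦ (c', g)` over `K` (`GammaField.IsGammaIso.append_of_ringHom_adjoin`), and
  `K + ℚc' + ℚg ◁ F` by Lemma 4.8 (`δ(g/K + ℚc') = 0`).

## References

* M. Bays, J. Kirby, *Pseudo-exponential maps, variants, and quasiminimality*, Algebra & Number
  Theory 12 (2018) 493–549: Def. 3.19, Prop. 3.22, Lemma 4.8, Prop. 7.3, Cor. 7.4, Lemma 8.3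
  (proof), Def. 11.1, Prop. 11.2, Thm 11.6 (proof).
-/

noncomputable section

open Set MvPolynomial

universe u

namespace Literature.NumberTheory.Transcendental

namespace GammaField

open Literature.ModelTheory.ExponentialFields.ExponentialRing ZilberSaturationMain
  Literature.FieldTheory.Regular Literature.FieldTheory.Kummer

attribute [local instance] MvPolynomial.algebraMvPolynomial

variable {F : Type u} [Field F] [CharZero F] [Literature.ModelTheory.ExponentialFields.ExponentialRing F]
variable {K : Submodule ℚ F} {N n : ℕ}

set_option synthInstance.maxHeartbeats 200000 in
set_option maxHeartbeats 400000 in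
/-- **The generic partner from GSΓC** (Bays–Kirby 2018, proof of Prop. 11.2 / Thm 11.6 along the
lines of Lemma 8.3). Let `K` be Γ-closed in the algebraically closed `F` and generically strongly
Γ-closed over `K`; `c ↦ c'` a Γ-isomorphism over `K` between tuples linearly independent over `K`
with `K + ℚc ◁ F`, `K + ℚc' ◁ F`; `b` an `n`-tuple linearly independent over `K + ℚc` with
`td(b/K + ℚc) = n`, *free* (no non-trivial `ℤ`-combination of `b`, nor its exponential, is
algebraic over `Γ(K + ℚc)`), and such that `⟨K c⟩` is relatively algebraically closed in
`⟨K c⟩(b, exp b)`. Then there is `g` with `(g, exp g)` a generic point of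
`θ(I((b, exp b)/⟨K c⟩))` over `⟨K c'⟩`, `g` linearly independent over `K + ℚc'`, and
`td(g/K + ℚc') = n`. [cite: BaysKirby2018ANT, Prop. 11.2, Thm 11.6 (proof), Lemma 8.3 (proof)] -/
theorem exists_generic_partner_of_gsgc [IsAlgClosed F] (hK : IsGammaClosed K)
    (hG : IsGenericallyStronglyGammaClosedOver K) {c c' : Fin N → F} (hiso : IsGammaIso K c c')
    (hc : LinIndepOver K c) (hc' : LinIndepOver K c')
    (hX : IsStrong (K ⊔ Submodule.span ℚ (range c)))
    (hX' : IsStrong (K ⊔ Submodule.span ℚ (range c'))) {b : Fin n → F}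
    (hb : LinIndepOver (K ⊔ Submodule.span ℚ (range c)) b)
    (htd : td (K ⊔ Submodule.span ℚ (range c)) (Submodule.span ℚ (range b)) = n)
    (hfree : ∀ m : Fin n → ℤ, m ≠ 0 →
      ∑ j, (m j : ℚ) • b j ∉ acl (gens (K ⊔ Submodule.span ℚ (range c))) ∧
      exp (∑ j, (m j : ℚ) • b j) ∉ acl (gens (K ⊔ Submodule.span ℚ (range c))))
    (hrac : ∀ z ∈ IntermediateField.adjoin (fieldOf K) (allGens c ∪ range (gammaPt b)),
      IsAlgebraic (bfld K c) z → z ∈ bfld K c) :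
    ∃ g : Fin n → F, IsGenericPt (locusIdeal' K hiso b) (gammaPt g) ∧
      LinIndepOver (K ⊔ Submodule.span ℚ (range c')) g ∧
      td (K ⊔ Submodule.span ℚ (range c')) (Submodule.span ℚ (range g)) = n := by
  classical
  haveI hP' : (locusIdeal' K hiso b).IsPrime := locusIdeal'_isPrime K hiso b
  -- `W₀ = Z(P')_F` is its own unique component (regularity)
  haveI hQ : ((locusIdeal' K hiso b).map (algebraMap (MvPolynomial (Fin n ⊕ Fin n) (bfld K c'))
      (MvPolynomial (Fin n ⊕ Fin n) F))).IsPrime := by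
    rw [MvPolynomial.algebraMap_def]
    exact isPrime_map_locusIdeal' hiso b hrac
  have hQmin : (locusIdeal' K hiso b).map (algebraMap (MvPolynomial (Fin n ⊕ Fin n) (bfld K c'))
      (MvPolynomial (Fin n ⊕ Fin n) F)) ∈ ((locusIdeal' K hiso b).map (algebraMap
        (MvPolynomial (Fin n ⊕ Fin n) (bfld K c')) (MvPolynomial (Fin n ⊕ Fin n) F))).minimalPrimes := by
    rw [Ideal.minimalPrimes_eq_subsingleton_self]
    exact mem_singleton _
  -- data on the generic point of `P`, transported to `P'` (as in `exists_generic_partner`)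
  have hY : ∀ i, (MvPolynomial.X (Sum.inr i) : MvPolynomial (Fin n ⊕ Fin n) (bfld K c')) ∉
      locusIdeal' K hiso b := fun i =>
    (LocusComponents.X_inr_notMem_mapCoeff_iff hiso.fieldEquiv (locusIdeal K c b) i).2
      (X_inr_notMem_locusIdeal K c b i)
  have hrot : ∀ M : Matrix (Fin n) (Fin n) ℤ,
      ∃ s : Fin (M.map (Int.cast : ℤ → ℚ)).rank → Fin n ⊕ Fin n,
        AlgebraicIndependent (bfld K c') fun i => matrixAct M (genericPt (locusIdeal' K hiso b)) (s i) := by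
    intro M
    obtain ⟨s, hs⟩ := exists_algebraicIndependent_matrixAct K c b hX hb M
    refine ⟨s, LocusComponents.algebraicIndependent_matrixAct_genericPt_mapCoeff hiso.fieldEquiv
      (locusIdeal K c b) M s ?_⟩
    exact LocusComponents.algebraicIndependent_matrixAct_genericPt (locusIdeal K c b)
      (isGenericPt_locusIdeal K c b) M s hs
  have hadd : ∀ m : Fin n → ℤ, m ≠ 0 → Transcendental (bfld K c')
      (∑ i, (m i : zeroLocusFunctionField (locusIdeal' K hiso b)) *
        genericPt (locusIdeal' K hiso b) (Sum.inl i)) := by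
    intro m hm
    refine LocusComponents.transcendental_sum_genericPt_mapCoeff hiso.fieldEquiv (locusIdeal K c b) m ?_
    exact LocusComponents.transcendental_sum_genericPt (locusIdeal K c b) (isGenericPt_locusIdeal K c b) m
      (transcendental_sum K c b m (hfree m hm).1)
  have hmul : ∀ m : Fin n → ℤ, m ≠ 0 → Transcendental (bfld K c')
      (∏ i, genericPt (locusIdeal' K hiso b) (Sum.inr i) ^ m i) := by
    intro m hm
    refine LocusComponents.transcendental_prod_genericPt_mapCoeff hiso.fieldEquiv (locusIdeal K c b) m ?_
    exact LocusComponents.transcendental_prod_genericPt (locusIdeal K c b) (isGenericPt_locusIdeal K c b) m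
      (transcendental_prod K c b m (hfree m hm).2)
  -- the hypotheses of GSΓC for `W₀`
  have hirr : IsIrreducibleClosed F (zeroLocus F ((locusIdeal' K hiso b).map (algebraMap
      (MvPolynomial (Fin n ⊕ Fin n) (bfld K c')) (MvPolynomial (Fin n ⊕ Fin n) F)))) :=
    LocusComponents.isIrreducibleClosed_component
  have hne := LocusComponents.component_inter_torusLocus_nonempty hQmin hY
  have hrotW := LocusComponents.isRotund_component hQmin hY hrot
  have haddW := LocusComponents.isAddFree_component hQmin hY hadd
  have hmulW := LocusComponents.isMulFree_component hQmin hY hmul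
  have hdimP : ringKrullDim (zeroLocusCoordRing (locusIdeal K c b)) = n :=
    ringKrullDim_coordRing_locusIdeal_eq K c b htd
  have hdimP' : ringKrullDim (zeroLocusCoordRing (locusIdeal' K hiso b)) = n := by
    rw [locusIdeal', LocusComponents.ringKrullDim_quotient_mapCoeff]; exact hdimP
  have hdimW : zariskiDim F (zeroLocus F ((locusIdeal' K hiso b).map (algebraMap
      (MvPolynomial (Fin n ⊕ Fin n) (bfld K c')) (MvPolynomial (Fin n ⊕ Fin n) F)))) = n := by
    rw [LocusComponents.zariskiDim_component hQmin]; exact hdimP'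
  -- the field of definition `K(c'/M!, exp (c'/M!))` and the strongly rotund `W`
  obtain ⟨M₀, hM₀⟩ := exists_forall_isDefinedOver_adjoinPt hiso b
  have hdef := hM₀ M₀ le_rfl
  have hlinA : LinIndepOver K fun i => c' i / (M₀.factorial : F) := linIndepOver_div_factorial hc' M₀
  have hstrA : IsStrong (K ⊔ Submodule.span ℚ (range fun i => c' i / (M₀.factorial : F))) := by
    rw [span_range_div_factorial]; exact hX'
  have hlin : LinIndepOver K (Fin.append (fun i => c i / (M₀.factorial : F)) b) := by
    refine (linIndepOver_div_factorial hc M₀).append ?_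
    rw [span_range_div_factorial]; exact hb
  have hsrot := isStronglyRotund_locOver hK hiso b M₀ hne hlin
  -- GSΓC
  obtain ⟨g, hgW, hglin⟩ := hG n N _ _ hirr hne hdimW haddW hmulW hrotW hlinA hstrA hdef hsrot
  rw [span_range_div_factorial] at hglin
  -- genericity from `td(g/K + ℚc') ≥ n` (as in `exists_generic_partner`)
  have hfg : IsFG (K ⊔ Submodule.span ℚ (range c')) (Submodule.span ℚ (range g)) :=
    isFG_span_of_finite _ (finite_range g)
  have hδ : 0 ≤ predim (K ⊔ Submodule.span ℚ (range c')) (Submodule.span ℚ (range g)) :=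
    (isStrong_iff.1 hX') _ hfg
  have hldim : ldim (K ⊔ Submodule.span ℚ (range c')) (Submodule.span ℚ (range g)) = n :=
    ldim_span_eq_of_linIndepOver hglin
  have htd_ge : (n : ℕ∞) ≤ td (K ⊔ Submodule.span ℚ (range c')) (Submodule.span ℚ (range g)) := by
    rw [predim_def, hldim] at hδ
    have h1 : n ≤ (td (K ⊔ Submodule.span ℚ (range c')) (Submodule.span ℚ (range g))).toNat := by omega
    rw [← ENat.coe_toNat (td_ne_top hfg)]
    exact_mod_cast h1
  have hrel : (algMatroid F).relRank (((bfld K c').restrictScalars ℚ : IntermediateField ℚ F) : Set F)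
      (range (gammaPt g)) = td (K ⊔ Submodule.span ℚ (range c')) (Submodule.span ℚ (range g)) :=
    relRank_range_gammaPt K c' g
  have hzP' : gammaPt g ∈ zeroLocus F (locusIdeal' K hiso b) :=
    LocusComponents.zeroLocus_subset_zeroLocus hQmin hgW
  have htrP' : Algebra.trdeg (bfld K c') (zeroLocusCoordRing (locusIdeal' K hiso b)) = n := by
    have h1 := Literature.RingTheory.KrullDimension.ringKrullDim_eq_trdeg (bfld K c')
      (zeroLocusCoordRing (locusIdeal' K hiso b))
    rw [hdimP'] at h1
    have h2 : Cardinal.toNat (Algebra.trdeg (bfld K c') (zeroLocusCoordRing (locusIdeal' K hiso b))) = n := by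
      exact_mod_cast h1.symm
    rw [Literature.RingTheory.KrullDimension.trdeg_eq_toNat (bfld K c')
      (zeroLocusCoordRing (locusIdeal' K hiso b)), h2]
  have hgen : IsGenericPt (locusIdeal' K hiso b) (gammaPt g) := by
    refine LocusComponents.isGenericPt_of_trdeg_le _ hzP' ?_
    rw [htrP']
    refine Cardinal.natCast_le_toENat.1 ?_
    rw [toENat_trdeg_adjoin_bfld, hrel]
    exact htd_ge
  have htd_eq : td (K ⊔ Submodule.span ℚ (range c')) (Submodule.span ℚ (range g)) = n := by
    refine le_antisymm ?_ htd_ge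
    rw [← hrel, ← toENat_trdeg_adjoin_bfld, ← trdeg_coordRing_eq_of_isGenericPt hgen, htrP',
      Cardinal.toENat_nat]
  exact ⟨g, hgen, hglin, htd_eq⟩

/-- **The isomorphism step** (Bays–Kirby 2018, end of the proof of Lemma 8.3, here for
Prop. 11.2): in the situation of `exists_generic_partner_of_gsgc`, if moreover
`exp b₁, …, exp bₙ` are independent modulo `m`-th powers in `⟨K c⟩(b, exp b)` for every `m ≥ 1`
(a normalised good basis, `GammaField.exists_relative_normalised_basis`), then there is `g`
with `(c, b) ↦ (c', g)` a Γ-isomorphism over `K` and `K + ℚc' + ℚg ◁ F`: genericity of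
`(g, exp g)` in `θ(I((b, exp b)/⟨K c⟩))` gives a field embedding `⟨K c⟩(b, exp b) → F` over `θ`
with `(b, exp b) ↦ (g, exp g)` (`GammaField.pointFieldHom`), which extends to all division points
by Kummer theory (`GammaField.IsGammaIso.append_of_ringHom_adjoin`); strongness is Lemma 4.8.
[cite: BaysKirby2018ANT, Prop. 11.2, Lemma 8.3 (proof), Prop. 3.22, Lemma 4.8] -/
theorem exists_isGammaIso_append_of_gsgc [IsAlgClosed F] (hK : IsGammaClosed K)
    (hG : IsGenericallyStronglyGammaClosedOver K) {c c' : Fin N → F} (hiso : IsGammaIso K c c')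
    (hc : LinIndepOver K c) (hc' : LinIndepOver K c')
    (hX : IsStrong (K ⊔ Submodule.span ℚ (range c)))
    (hX' : IsStrong (K ⊔ Submodule.span ℚ (range c'))) {b : Fin n → F}
    (hb : LinIndepOver (K ⊔ Submodule.span ℚ (range c)) b)
    (htd : td (K ⊔ Submodule.span ℚ (range c)) (Submodule.span ℚ (range b)) = n)
    (hfree : ∀ m : Fin n → ℤ, m ≠ 0 →
      ∑ j, (m j : ℚ) • b j ∉ acl (gens (K ⊔ Submodule.span ℚ (range c))) ∧
      exp (∑ j, (m j : ℚ) • b j) ∉ acl (gens (K ⊔ Submodule.span ℚ (range c))))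
    (hrac : ∀ z ∈ IntermediateField.adjoin (fieldOf K) (allGens c ∪ range (gammaPt b)),
      IsAlgebraic (bfld K c) z → z ∈ bfld K c)
    (hkum : ∀ m, 0 < m → IndepModPowers m (fun j =>
      (⟨exp (b j), IntermediateField.subset_adjoin _ _ (Or.inr ⟨Sum.inr j, rfl⟩)⟩ :
        IntermediateField.adjoin (fieldOf K) (allGens c ∪ range (gammaPt b))))) :
    ∃ g : Fin n → F, IsGammaIso K (Fin.append c b) (Fin.append c' g) ∧
      IsStrong (K ⊔ Submodule.span ℚ (range (Fin.append c' g))) := by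
  classical
  obtain ⟨g, hgen, hglin, htd'⟩ :=
    exists_generic_partner_of_gsgc hK hG hiso hc hc' hX hX' hb htd hfree hrac
  -- the field embedding `⟨K c⟩(b, exp b) → F` over `θ` with `(b, exp b) ↦ (g, exp g)`
  let σ : bfld K c →+* F := (algebraMap (bfld K c') F).comp (hiso.fieldEquiv : bfld K c →+* bfld K c')
  have hiff : ∀ p : MvPolynomial (Fin n ⊕ Fin n) (bfld K c),
      aeval (gammaPt b) p = 0 ↔ eval₂ σ (gammaPt g) p = 0 := by
    intro p
    have h1 : aeval (gammaPt b) p = 0 ↔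
        MvPolynomial.map (hiso.fieldEquiv : bfld K c →+* bfld K c') p ∈ locusIdeal' K hiso b := by
      rw [mem_locusIdeal'_iff, MvPolynomial.map_map, RingEquiv.symm_comp, MvPolynomial.map_id]
    rw [h1, ← hgen, aeval_def, eval₂_map]
  let τ₂ := pointFieldHom σ (gammaPt b) (gammaPt g) hiff
  -- precompose with the identification of the flat field with `⟨K c⟩(b, exp b)`
  have hmemΩ₂ : ∀ z : F, z ∈ IntermediateField.adjoin (fieldOf K) (allGens c ∪ range (gammaPt b)) →
      z ∈ IntermediateField.adjoin (bfld K c) (range (gammaPt b)) := by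
    intro z hz
    rw [← IntermediateField.mem_restrictScalars (fieldOf K), IntermediateField.adjoin_adjoin_left]
    exact hz
  let jf : IntermediateField.adjoin (fieldOf K) (allGens c ∪ range (gammaPt b)) →+*
      IntermediateField.adjoin (bfld K c) (range (gammaPt b)) :=
    { toFun := fun x => ⟨x, hmemΩ₂ x x.2⟩
      map_one' := Subtype.ext rfl
      map_mul' := fun _ _ => Subtype.ext rfl
      map_zero' := Subtype.ext rfl
      map_add' := fun _ _ => Subtype.ext rfl }
  let τ : IntermediateField.adjoin (fieldOf K) (allGens c ∪ range (gammaPt b)) →+* F := τ₂.comp jf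
  have hτE : ∀ (z : F) (hz : z ∈ IntermediateField.adjoin (fieldOf K) (allGens c)),
      τ ⟨z, adjoinField_le_adjoin_union c b hz⟩ = (hiso.fieldEquiv ⟨z, hz⟩ : F) := by
    intro z hz
    have hj : jf ⟨z, adjoinField_le_adjoin_union c b hz⟩ =
        algebraMap (bfld K c) (IntermediateField.adjoin (bfld K c) (range (gammaPt b))) ⟨z, hz⟩ :=
      Subtype.ext (by rw [IntermediateField.coe_algebraMap_apply, IntermediateField.algebraMap_apply]; rfl)
    show τ₂ (jf ⟨z, _⟩) = _
    rw [hj, pointFieldHom_algebraMap]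
    simp only [σ, RingHom.coe_comp, Function.comp_apply]
    rw [IntermediateField.algebraMap_apply]
    rfl
  have hτb : ∀ j, τ ⟨b j, IntermediateField.subset_adjoin _ _ (Or.inr ⟨Sum.inl j, rfl⟩)⟩ = g j := by
    intro j
    have hj : jf ⟨b j, IntermediateField.subset_adjoin _ _ (Or.inr ⟨Sum.inl j, rfl⟩)⟩ =
        ⟨gammaPt b (Sum.inl j), IntermediateField.subset_adjoin _ _ (mem_range_self _)⟩ := Subtype.ext rfl
    show τ₂ (jf ⟨b j, _⟩) = _
    rw [hj, pointFieldHom_apply_self, gammaPt_inl]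
  have hτe : ∀ j, τ ⟨exp (b j), IntermediateField.subset_adjoin _ _ (Or.inr ⟨Sum.inr j, rfl⟩)⟩ = exp (g j) := by
    intro j
    have hj : jf ⟨exp (b j), IntermediateField.subset_adjoin _ _ (Or.inr ⟨Sum.inr j, rfl⟩)⟩ =
        ⟨gammaPt b (Sum.inr j), IntermediateField.subset_adjoin _ _ (mem_range_self _)⟩ := Subtype.ext rfl
    show τ₂ (jf ⟨exp (b j), _⟩) = _
    rw [hj, pointFieldHom_apply_self, gammaPt_inr]
  have hγ : IsGammaIso K (Fin.append c b) (Fin.append c' g) :=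
    hiso.append_of_ringHom_adjoin hK τ hτE hτb hτe hkum
  -- strongness of `K + ℚc' + ℚg` (Lemma 4.8, `δ(g/K + ℚc') = 0`)
  have hfg : IsFG (K ⊔ Submodule.span ℚ (range c')) (Submodule.span ℚ (range g)) :=
    isFG_span_of_finite _ (finite_range g)
  have hldim : ldim (K ⊔ Submodule.span ℚ (range c')) (Submodule.span ℚ (range g)) = n :=
    ldim_span_eq_of_linIndepOver hglin
  have hδ0 : predim (K ⊔ Submodule.span ℚ (range c'))
      ((K ⊔ Submodule.span ℚ (range c')) ⊔ Submodule.span ℚ (range g)) = 0 := by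
    rw [predim_sup_left, predim_def, hldim, htd']
    simp
  have hstrong : IsStrong ((K ⊔ Submodule.span ℚ (range c')) ⊔ Submodule.span ℚ (range g)) :=
    hX'.of_predim_eq_zero le_sup_left (isFG_sup_left.2 hfg) hδ0
  refine ⟨g, hγ, ?_⟩
  rw [ZilberHomogeneity.range_append, Submodule.span_union, ← sup_assoc]
  exact hstrong

end GammaField

end Literature.NumberTheory.Transcendental
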